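import Summits.BirchSwinnertonDyer.BirchSwinnertonDyer.Theorems.PrintCf2SplitBadTwoLineUnrSelmerTransport
import HarnessLib

/-!
# Crux `PrintCf2.SplitBadTwoRankOneOfFacts` (stmt-BirchSwinnertonDyer-20368), S3a-quad brick (e2): INFLATION–RESTRICTION ALONG A
# FINITE CYCLIC QUOTIENT, IIIa — TRANSFER OF THE DATUM SELMER CONDITIONS BACK ALONG `res` WHEN THE LOCAL RESTRICTIONS ARE INJECTIVE
# (the inertia groups `H ⊓ I_w` and `H′ ⊓ I_w` may DIFFER)

Cell `bsd-print-cf2`, width seat `bsd-line-cf2-p1-w5` g6 («width 5»), `--supports stmt-BirchSwinnertonDyer-20368 --as helper`, Theses-free.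
HONEST FRAMING: nothing here closes the crux or a registered stub; no summit statement is proved by this seat; BSD is not proved by any of this.
No definition, no named fact, no `sorry`. Part of the series `…CyclicInfRes` (I), `…CyclicInfResFinite` (II), this file (IIIa), `…CyclicInfResSelmer`
(IIIb), `…CyclicInfResSign` (IVa), `…CyclicInfResChar` (IVb).

For `H′ ≤ H ≤ Γ_K` (normal), a discrete `M`, `p`, Castella's datum `bdpData M p 𝔭`, `S₀`: -w6 g4's
`LineTransport.resOfLe_mem_datumSelmer_bdpData_iff` transfers the conditions of `Sel(·) = datumSelmer · M p (bdpData M p 𝔭) S₀` both ways along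
`res` when `H ⊓ I_w ≤ H′` (EQUAL inertia groups). Here the hypothesis is weakened to INJECTIVITY of the local restriction maps
`H¹(H ⊓ I_w, ·) → H¹(H′ ⊓ I_w, ·)` (`resOfLe_mem_unramifiedKer_iff_of_injective`, `…greenbergKer_iff_of_injective`,
`…unramifiedOutside_iff_of_injective`, **`resOfLe_mem_datumSelmer_bdpData_iff_of_injective`**), which holds with DIFFERENT inertia groups in the
case of a quadratic twist ramified at `w` (file IVa: the coset acts by `−1` on a `2`-divisible module; cf. cf2c-w2 g3's `SignTransport`, p694024,
the same phenomenon at `p = 2` by a cocycle computation). This is the `hback` input of file IIIb's cokernel theorems.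

presearch: Greenberg–Vatsal 2000 §2 p. 17; Greenberg LNM 1716 §3 Lemma 3.3 — held, cited. beyond-print theorem: no.

References: [GreenbergVatsal2000] §2 pp. 16–17, 20; [Greenberg1989] §1 p. 98 (4); [Castella2018] Def. 2.2.
-/

noncomputable section

open scoped Classical

set_option linter.dupNamespace false -- D-0017: `…BirchSwinnertonDyer.BirchSwinnertonDyer…` repeats a namespace by design
set_option autoImplicit false

open NumberField IsDedekindDomain Field
open Literature.NumberTheory.EllipticCurves Literature.NumberTheory.EllipticCurves.GreenbergSelmer
open Literature.NumberTheory.EllipticCurves.GreenbergVatsal2000 Literature.NumberTheory.EllipticCurves.Castella2018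
open Literature.NumberTheory.GaloisRepresentations
open Summit.BirchSwinnertonDyer.BirchSwinnertonDyer.Theorems.IwasawaTwoVariable

universe u

namespace Summit.BirchSwinnertonDyer.BirchSwinnertonDyer.Theorems.PrintCf2.CyclicInfResSelmer

variable {K : Type u} [Field K] [NumberField K] {H' H : Subgroup (absoluteGaloisGroup K)}
  {M : Type u} [AddCommGroup M] [DistribMulAction (absoluteGaloisGroup K) M] [TopologicalSpace M] [DiscreteTopology M]

/-! ## §1. Local conditions transfer back along `res` when the local restrictions are injective -/

/-- **Unramifiedness transfers both ways along `H′ ≤ H` when `H¹(H ⊓ I_w, M) → H¹(H′ ⊓ I_w, M)` is injective**: `res c` is unramified at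
the chosen place above `w` iff `c` is (restriction commutes with the local maps, `resH1Hom_inertiaIn_resOfLe_id`). Generalises
`LineTransport.resOfLe_mem_unramifiedKer_iff_of_inf_inertia_le` (equal inertia groups). [cite: GreenbergVatsal2000, §2 p. 17] -/
theorem resOfLe_mem_unramifiedKer_iff_of_injective (hle : H' ≤ H) {w : HeightOneSpectrum (𝓞 K)}
    (hinj : Function.Injective (Literature.NumberTheory.EllipticCurves.resOfLe M (inertiaIn_mono hle w)))
    (c : subgroupH1 H M) : resOfLe M hle c ∈ unramifiedKer H' M w ↔ c ∈ unramifiedKer H M w := by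
  refine ⟨fun h ↦ ?_, fun h ↦ resOfLe_mem_unramifiedKer hle w h⟩
  have h' : resH1Hom (inertiaInToH H' w) (AddMonoidHom.id M) (id_smul_inertiaInToH H' w) (resOfLe M hle c) = 0 := h
  rw [resH1Hom_inertiaIn_resOfLe_id] at h'
  exact (injective_iff_map_eq_zero _).1 hinj _ h'

/-- **Greenberg's condition transfers both ways along `H′ ≤ H` when `H¹(H ⊓ I_w, M/M⁺_w) → H¹(H′ ⊓ I_w, M/M⁺_w)` is injective**, for any
local datum `N = M⁺_w` (`greenbergMap_resOfLe`). [cite: GreenbergVatsal2000, §2 pp. 17, 20] [cite: Greenberg1989, §1 p. 98 (4)] -/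
theorem resOfLe_mem_greenbergKer_iff_of_injective (hle : H' ≤ H) {w : HeightOneSpectrum (𝓞 K)} (N : LocalDatum K M w)
    (hinj : Function.Injective (Literature.NumberTheory.EllipticCurves.resOfLe N.Gr (inertiaIn_mono hle w)))
    (c : subgroupH1 H M) : resOfLe M hle c ∈ N.greenbergKer H' ↔ c ∈ N.greenbergKer H := by
  refine ⟨fun h ↦ ?_, fun h ↦ resOfLe_mem_greenbergKer hle N h⟩
  rw [LocalDatum.mem_greenbergKer_iff, greenbergMap_resOfLe] at h
  rw [LocalDatum.mem_greenbergKer_iff]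
  exact (injective_iff_map_eq_zero _).1 hinj _ h

variable [H'.Normal] [H.Normal] (p : ℕ) (S₀ : Set (HeightOneSpectrum (𝓞 K)))

/-- **`res c` is unramified outside `p` (off `S₀`) over `K̄^{H′}` iff `c` is over `K̄^H`**, given injectivity of the local restrictions at
every finite `w ∤ p` off `S₀` (place by place, every conjugate: `resOfLe_conjH1_comm`). [cite: GreenbergVatsal2000, §2 pp. 16–17] -/
theorem resOfLe_mem_unramifiedOutside_iff_of_injective (hle : H' ≤ H)
    (hinj : ∀ w : HeightOneSpectrum (𝓞 K), w ∉ S₀ → ((p : ℕ) : 𝓞 K) ∉ w.asIdeal →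
      Function.Injective (Literature.NumberTheory.EllipticCurves.resOfLe M (inertiaIn_mono hle w)))
    (c : subgroupH1 H M) : resOfLe M hle c ∈ unramifiedOutside H' M p S₀ ↔ c ∈ unramifiedOutside H M p S₀ := by
  rw [mem_unramifiedOutside_iff, mem_unramifiedOutside_iff]
  refine forall_congr' fun w ↦ forall_congr' fun hw ↦ forall_congr' fun hpw ↦ forall_congr' fun σ ↦ ?_
  rw [← resOfLe_conjH1_comm hle]
  exact resOfLe_mem_unramifiedKer_iff_of_injective hle (hinj w hw hpw) _

/-- **The datum Selmer conditions for `bdpData M p 𝔭` transfer both ways along `H′ ≤ H`** (normal in `Γ_K`), given injectivity of the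
local restrictions at every finite `w ∤ p` off `S₀` (coefficients `M`) and at `𝔭` (coefficients `M ⧸ M⁺_𝔭` of the strict datum); nothing is
asked above the other primes over `p`, where Greenberg's condition is vacuous (`greenbergKer_relaxedDatum_eq_top`):
`res c ∈ Sel(H′) ↔ c ∈ Sel(H)`. Generalises `LineTransport.resOfLe_mem_datumSelmer_bdpData_iff` to DIFFERING inertia groups.
[cite: GreenbergVatsal2000, §2 pp. 16–17, 20] [cite: Castella2018, Def. 2.2 (arXiv:1704.06608 p. 5)] -/
theorem resOfLe_mem_datumSelmer_bdpData_iff_of_injective (hle : H' ≤ H) (𝔭 : HeightOneSpectrum (𝓞 K))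
    (hinj : ∀ w : HeightOneSpectrum (𝓞 K), w ∉ S₀ → ((p : ℕ) : 𝓞 K) ∉ w.asIdeal →
      Function.Injective (Literature.NumberTheory.EllipticCurves.resOfLe M (inertiaIn_mono hle w)))
    (hinj𝔭 : ∀ h𝔭 : ((p : ℕ) : 𝓞 K) ∈ 𝔭.asIdeal,
      Function.Injective (Literature.NumberTheory.EllipticCurves.resOfLe (AcSelmer.bdpData M p 𝔭 𝔭 h𝔭).Gr (inertiaIn_mono hle 𝔭)))
    (c : subgroupH1 H M) :
    resOfLe M hle c ∈ datumSelmer H' M p (AcSelmer.bdpData M p 𝔭) S₀ ↔ c ∈ datumSelmer H M p (AcSelmer.bdpData M p 𝔭) S₀ := by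
  rw [mem_datumSelmer_iff, mem_datumSelmer_iff, resOfLe_mem_unramifiedOutside_iff_of_injective p S₀ hle hinj]
  refine and_congr Iff.rfl (forall_congr' fun w ↦ forall_congr' fun hw ↦ forall_congr' fun σ ↦ ?_)
  rw [← resOfLe_conjH1_comm hle]
  by_cases hw𝔭 : w = 𝔭
  · subst hw𝔭
    exact resOfLe_mem_greenbergKer_iff_of_injective hle _ (hinj𝔭 hw) _
  · rw [AcSelmer.bdpData_of_ne p 𝔭 hw hw𝔭, greenbergKer_relaxedDatum_eq_top, greenbergKer_relaxedDatum_eq_top]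
    simp only [AddSubgroup.mem_top]

end Summit.BirchSwinnertonDyer.BirchSwinnertonDyer.Theorems.PrintCf2.CyclicInfResSelmer

end
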